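import Summits.Parity.GeneralizedHardyLittlewood.Theorems.LeeYangFibresAbsoluteUpgradeUniformDefs
import Summits.Parity.GeneralizedHardyLittlewood.Theorems.LeeYangFibresRelativeDimOneTightness
import HarnessLib

/-!
# Route `LeeYangFibres`, crux `AbsoluteUpgrade` (stmt-Parity-14116), line `Sketch` (uniform amplification):
# the SHARPENED residual — relative Hardy–Littlewood for translate-constellations only

Route-posited statement types (D-0016 `<Route><Crux>Defs` file, second part; the first part is
`Theorems/LeeYangFibresAbsoluteUpgradeUniformDefs.lean`).  NOTHING IS ASSERTED: both `def … : Prop` below are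
types of registered stubs of the skeleton `Cruxes/AbsoluteUpgrade/Lines/Sketch.lean`; the one theorem,
`translateUniformRelativeDimOne_of_uniform` (S⁺ ⟹ S⁺_transl), is the registered sub-goal this file lands under.

WHY (lead seat c10, cycle 2).  The amplification theorem `dimOne_of_uniformRelativeDimOne :
UniformRelativeDimOne → DimOne` (door (b), `Theorems/LeeYangFibresAbsoluteUpgradeUniformDoor.lean`) consumes its
hypothesis S⁺ = `UniformRelativeDimOne` (relative Dickson–Hardy–Littlewood uniform in the number of forms
`t ≤ (log log N)^A`, ALL non-degenerate systems of size `≤ L·t`) only at the translate-constellations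
`Ψ^{(H)} = (ψ_i(· + H'_j))_{j ≤ m, i < t}` of the given `t`-system `Ψ` on the bodies `K_H = K ∩ ⋂_j (K − H_j)`
(`m = 0` being `Ψ` on `K` itself).  These are very special systems: `(m+1) t` forms but only `t` linear parts, the
constants moving along the shifts `|H_j| ≤ 2N`.  `TranslateUniformRelativeDimOne` asks relative Hardy–Littlewood for
exactly these instances, uniformly in `(m+1) t ≤ (log log N)^A` — for `t = 1`, `ψ = n` it is the prime `k`-tuple
conjecture with RELATIVE error `ε(𝔖(H) N + N)` uniformly in `k ≤ (log log N)^A` shifts `|h_j| ≤ 2N`.  It is implied by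
S⁺ and still implies `DimOne` (`AmplificationFromTranslates`), so it replaces S⁺ as the line's residual: the weakest
statement the mechanism is known to need.

References: B. Green, T. Tao, Ann. of Math. 171 (2010), Conj. 1.2 / Conj. 1.4 [GreenTao2010]; P. X. Gallagher,
Mathematika 23 (1976), §2 [Gallagher1976].
-/

noncomputable section

open scoped BigOperators Classical
open Finset MeasureTheory Literature.NumberTheory.Sieve
open Summit.Parity.GeneralizedHardyLittlewood.Theses.LeeYangFibres (DimOne)
open Summit.Parity.GeneralizedHardyLittlewood.Cruxes.RelativeDimOne.TranslateAmplification

namespace Summit.Parity.GeneralizedHardyLittlewood.Cruxes.AbsoluteUpgrade.UniformAmplification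

/-- **S⁺_transl = `TranslateUniformRelativeDimOne`** (the line's sharpened conjectural residual): relative
Dickson–Hardy–Littlewood with Green–Tao's Conj. 1.4 error shape `ε(β_∞𝔖 + N)`, demanded ONLY for the non-degenerate
translate-constellations `Ψ^{(H)}`, `H ∈ [-2N,2N]^m`, of non-degenerate one-dimensional `t`-systems `Ψ` with
`‖Ψ‖_N ≤ L`, on the bodies `K_H`, uniformly in the number of translates `(m+1) t ≤ (log log N)^A` (the quantifier
shape of `UniformSingularMean`).  Implied by `UniformRelativeDimOne`; implies `DimOne` (`AmplificationFromTranslates`),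
hence at least as strong as the target stmt-Parity-0819. (References in the module docstring.) -/
def TranslateUniformRelativeDimOne : Prop :=
  ∀ (t L A : ℕ), 1 ≤ t → ∀ ε : ℝ, 0 < ε → ∃ N₀ : ℕ, ∀ N : ℕ, N₀ ≤ N → ∀ m : ℕ,
    (((m + 1) * t : ℕ) : ℝ) ≤ Real.log (Real.log N) ^ A →
    ∀ Ψ : Fin t → AffLinForm 1, IsNondegenerateSystem Ψ → affLinSize Ψ N ≤ L →
      ∀ K : Set (Fin 1 → ℝ), Convex ℝ K → K ⊆ realBox 1 N →
        ∀ H ∈ shiftBox m N, IsNondegenerateSystem (translateFamily Ψ H) →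
          |vonMangoldtSum (translateFamily Ψ H) (meetTranslates K H) N -
              archFactor (translateFamily Ψ H) (meetTranslates K H) *
                singularProduct (translateFamily Ψ H)| ≤
            ε * (archFactor (translateFamily Ψ H) (meetTranslates K H) *
                singularProduct (translateFamily Ψ H) + N)

/-- **F′ = `AmplificationFromTranslates`**: the tensor-power transfer fed by the sharpened residual,
`UniformSingularMean → CollisionFormFacts → TranslateUniformRelativeDimOne → DimOne`.
(References in the module docstring.) -/
def AmplificationFromTranslates : Prop :=
  UniformSingularMean → CollisionFormFacts → TranslateUniformRelativeDimOne → DimOne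

/-- **S⁺ implies S⁺_transl** (registered sub-goal of this vocabulary file): `UniformRelativeDimOne` applied to the
`(m+1)t`-system `Ψ^{(H)}` (size `≤ (3m+1) L ≤ (3L)·(m+1)t` on the shift box, `affLinSize_translateFamily_le`) on the convex
body `K_H ⊆ K ⊆ [-N, N]`. [cite: GreenTao2010, Conj. 1.4] -/
theorem translateUniformRelativeDimOne_of_uniform : UniformRelativeDimOne → TranslateUniformRelativeDimOne := by
  intro h t L A ht ε hε
  obtain ⟨N₀, hN₀⟩ := h A (3 * L) ε hε
  refine ⟨max N₀ 1, fun N hN m hT Ψ _hΨ hL K hK hKN H hH hnd => ?_⟩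
  have hN0 : N₀ ≤ N := le_trans (le_max_left _ _) hN
  have hN1 : 1 ≤ N := le_trans (le_max_right _ _) hN
  have hT1 : 1 ≤ (m + 1) * t := le_trans ht (Nat.le_mul_of_pos_left t (Nat.succ_pos m))
  have hsize : affLinSize (translateFamily Ψ H) N ≤ ((3 * L : ℕ) : ℝ) * (((m + 1) * t : ℕ) : ℝ) := by
    refine (affLinSize_translateFamily_le hN1 hL hH).trans ?_
    push_cast
    have hL0 : (0 : ℝ) ≤ L := Nat.cast_nonneg L
    have hm0 : (0 : ℝ) ≤ m := Nat.cast_nonneg m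
    have ht1 : (1 : ℝ) ≤ t := by exact_mod_cast ht
    have h1 : 3 * (m : ℝ) + 1 ≤ 3 * (((m : ℝ) + 1) * t) := by nlinarith
    calc (3 * (m : ℝ) + 1) * L ≤ 3 * (((m : ℝ) + 1) * t) * L := mul_le_mul_of_nonneg_right h1 hL0
      _ = 3 * L * ((m + 1) * t) := by ring
  exact hN₀ N hN0 ((m + 1) * t) hT1 hT (translateFamily Ψ H) hnd hsize (meetTranslates K H)
    (convex_meetTranslates hK H) ((meetTranslates_subset K H).trans hKN)

/-! ### The high-mass residual (appended, lead seat c10 cycle 3): `RelativeDimOne` becomes load-bearing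

The transfer uses relative Hardy–Littlewood for the BASE system `Ψ` on `K` only when the singular mass is LOW
(`β_∞(Ψ,K) 𝔖(Ψ) < 5N`), where it is exactly the crux's own hypothesis `RelativeDimOne` (relative error
`ε(β_∞𝔖 + N) ≤ 6εN` is already absolute); the translate-constellations with `m ≥ 1` translates are needed only at HIGH
mass `β_∞𝔖 ≥ 5N`.  Splitting the residual accordingly makes `RelativeDimOne` NON-INERT in the line:
`AbsoluteUpgrade_of hR := amplificationHighMass … hR stub_highMassTranslateRelativeDimOne`, and the remaining residual
`HighMassTranslateRelativeDimOne` no longer visibly contains the low-mass sector of the target (twin primes live there).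
-/

/-- **S⁺_high = `HighMassTranslateRelativeDimOne`** (the line's residual after cycle 3): `TranslateUniformRelativeDimOne`
demanded only for `m ≥ 1` translates of base instances `(Ψ, K)` of HIGH singular mass `β_∞(Ψ,K) 𝔖(Ψ) ≥ 5N`.  Implied by
`TranslateUniformRelativeDimOne`; together with `RelativeDimOne` (low mass) it gives `DimOne` (`AmplificationHighMass`),
i.e. it implies the CRUX `AbsoluteUpgrade` — whether it implies the target `DimOne` outright is not claimed.
(References in the module docstring.) -/
def HighMassTranslateRelativeDimOne : Prop :=
  ∀ (t L A : ℕ), 1 ≤ t → ∀ ε : ℝ, 0 < ε → ∃ N₀ : ℕ, ∀ N : ℕ, N₀ ≤ N → ∀ m : ℕ, 1 ≤ m →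
    (((m + 1) * t : ℕ) : ℝ) ≤ Real.log (Real.log N) ^ A →
    ∀ Ψ : Fin t → AffLinForm 1, IsNondegenerateSystem Ψ → affLinSize Ψ N ≤ L →
      ∀ K : Set (Fin 1 → ℝ), Convex ℝ K → K ⊆ realBox 1 N →
        5 * (N : ℝ) ≤ archFactor Ψ K * singularProduct Ψ →
        ∀ H ∈ shiftBox m N, IsNondegenerateSystem (translateFamily Ψ H) →
          |vonMangoldtSum (translateFamily Ψ H) (meetTranslates K H) N -
              archFactor (translateFamily Ψ H) (meetTranslates K H) *
                singularProduct (translateFamily Ψ H)| ≤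
            ε * (archFactor (translateFamily Ψ H) (meetTranslates K H) *
                singularProduct (translateFamily Ψ H) + N)

/-- **F″ = `AmplificationHighMass`**: the transfer with the crux hypothesis `RelativeDimOne` carrying the low-mass sector
and the high-mass residual carrying the rest:
`UniformSingularMean → CollisionFormFacts → RelativeDimOne → HighMassTranslateRelativeDimOne → DimOne`.
(References in the module docstring.) -/
def AmplificationHighMass : Prop :=
  UniformSingularMean → CollisionFormFacts → Summit.Parity.GeneralizedHardyLittlewood.Theses.LeeYangFibres.RelativeDimOne →
    HighMassTranslateRelativeDimOne → DimOne

/-- The sharpened residual implies the high-mass residual (drop the instances with `m = 0` or low mass). [folklore] -/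
theorem highMassTranslate_of_translateUniform :
    TranslateUniformRelativeDimOne → HighMassTranslateRelativeDimOne := by
  intro h t L A ht ε hε
  obtain ⟨N₀, hN₀⟩ := h t L A ht ε hε
  exact ⟨N₀, fun N hN m _hm hT Ψ hΨ hL K hK hKN _hM H hH hnd => hN₀ N hN m hT Ψ hΨ hL K hK hKN H hH hnd⟩

/-! ### The eventual-high-mass residual (appended, lead seat c10 cycle 4): only asymptotically maximal singular mass

`RelativeDimOne` gives absolute accuracy `εN` on every base instance of singular mass `β_∞𝔖 ≤ G·N` for EVERY fixed `G`
(relative error `ε/(G+1) · (β_∞𝔖 + N) ≤ εN`), so the transfer needs the translate-constellation hypothesis only above an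
ARBITRARY fixed mass threshold `G·N`, `G ≥ 5` (`amplificationHighMassAt`).  The residual therefore shrinks to the instances
of asymptotically maximal singular series (`𝔖(Ψ) ≥ G/2` for a `G` as large as one likes — the primorial-type alignments of the
census's "inhabited hard family"): `∃ G ≥ 5, HighMassTranslateRelativeDimOneAt G`.
-/

/-- **`HighMassTranslateRelativeDimOneAt G`**: `TranslateUniformRelativeDimOne` demanded only for `m ≥ 1` translates of base
instances `(Ψ, K)` of singular mass `β_∞(Ψ,K) 𝔖(Ψ) ≥ G·N` (`HighMassTranslateRelativeDimOne` is the case `G = 5`).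
(References in the module docstring.) -/
def HighMassTranslateRelativeDimOneAt (G : ℕ) : Prop :=
  ∀ (t L A : ℕ), 1 ≤ t → ∀ ε : ℝ, 0 < ε → ∃ N₀ : ℕ, ∀ N : ℕ, N₀ ≤ N → ∀ m : ℕ, 1 ≤ m →
    (((m + 1) * t : ℕ) : ℝ) ≤ Real.log (Real.log N) ^ A →
    ∀ Ψ : Fin t → AffLinForm 1, IsNondegenerateSystem Ψ → affLinSize Ψ N ≤ L →
      ∀ K : Set (Fin 1 → ℝ), Convex ℝ K → K ⊆ realBox 1 N →
        (G : ℝ) * N ≤ archFactor Ψ K * singularProduct Ψ →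
        ∀ H ∈ shiftBox m N, IsNondegenerateSystem (translateFamily Ψ H) →
          |vonMangoldtSum (translateFamily Ψ H) (meetTranslates K H) N -
              archFactor (translateFamily Ψ H) (meetTranslates K H) *
                singularProduct (translateFamily Ψ H)| ≤
            ε * (archFactor (translateFamily Ψ H) (meetTranslates K H) *
                singularProduct (translateFamily Ψ H) + N)

/-- **S⁺_∞ = `EventualHighMassTranslateRelativeDimOne`** (the line's residual after cycle 4): the translate-constellation
hypothesis above SOME fixed singular-mass threshold `G·N`, `G ≥ 5` — i.e. only for base instances of asymptotically maximal
singular series.  Implied by `HighMassTranslateRelativeDimOne` (`G = 5`); together with `RelativeDimOne` it gives `DimOne`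
(`AmplificationEventualHighMass`). (References in the module docstring.) -/
def EventualHighMassTranslateRelativeDimOne : Prop :=
  ∃ G : ℕ, 5 ≤ G ∧ HighMassTranslateRelativeDimOneAt G

/-- **F‴ = `AmplificationEventualHighMass`**:
`UniformSingularMean → CollisionFormFacts → RelativeDimOne → EventualHighMassTranslateRelativeDimOne → DimOne`.
(References in the module docstring.) -/
def AmplificationEventualHighMass : Prop :=
  UniformSingularMean → CollisionFormFacts → Summit.Parity.GeneralizedHardyLittlewood.Theses.LeeYangFibres.RelativeDimOne →
    EventualHighMassTranslateRelativeDimOne → DimOne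

/-- The threshold-`5` residual is the threshold-`G` residual at `G = 5`. [folklore] -/
theorem highMassTranslateRelativeDimOneAt_five :
    HighMassTranslateRelativeDimOne → HighMassTranslateRelativeDimOneAt 5 := by
  intro h t L A ht ε hε
  obtain ⟨N₀, hN₀⟩ := h t L A ht ε hε
  refine ⟨N₀, fun N hN m hm hT Ψ hΨ hL K hK hKN hM H hH hnd => hN₀ N hN m hm hT Ψ hΨ hL K hK hKN ?_ H hH hnd⟩
  exact_mod_cast hM

/-- Raising the threshold weakens the hypothesis: `At G → At G'` for `G ≤ G'`. [folklore] -/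
theorem highMassTranslateRelativeDimOneAt_mono {G G' : ℕ} (hGG' : G ≤ G') :
    HighMassTranslateRelativeDimOneAt G → HighMassTranslateRelativeDimOneAt G' := by
  intro h t L A ht ε hε
  obtain ⟨N₀, hN₀⟩ := h t L A ht ε hε
  refine ⟨N₀, fun N hN m hm hT Ψ hΨ hL K hK hKN hM H hH hnd => hN₀ N hN m hm hT Ψ hΨ hL K hK hKN ?_ H hH hnd⟩
  have hG : (G : ℝ) ≤ G' := by exact_mod_cast hGG'
  exact le_trans (mul_le_mul_of_nonneg_right hG (Nat.cast_nonneg N)) hM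

/-- The high-mass residual implies the eventual-high-mass residual (registered sub-goal of this appended part). [folklore] -/
theorem eventualHighMass_of_highMass :
    HighMassTranslateRelativeDimOne → EventualHighMassTranslateRelativeDimOne :=
  fun h => ⟨5, le_rfl, highMassTranslateRelativeDimOneAt_five h⟩

end Summit.Parity.GeneralizedHardyLittlewood.Cruxes.AbsoluteUpgrade.UniformAmplification

end
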